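import Literature.Probability.RandomPlanarGeometry.HexParafermionLoop
import HarnessLib

/-!
# The Duminil-Copin–Smirnov vertex relation with the root in a HOLE: the enclosing loop lemma and the
explicit defect

PRIOR TREE ART (cited by name, not re-proved): `HexSAWObservable.vertex_relation` (Lemma 1 for domains in a
half-plane), `HexParafermionLoop` (2026-08-15: `lw_nbrs_of_not_mem`, `pturn_lw_rev_of_wnd`, `pair_sum_of_wnd`,
`sum_clsLoop_eq_zero_of_wnd`, ★ `vertex_relation_of_wnd` — Lemma 1 for EVERY finite `V ∌ w` all of whose simple
cycles have winding number `0` about the root face `(1, 0)`), `HexParafermionWeighted.boundary_sum_weighted`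
(identity (5) under the same hypothesis), `HexParafermionProofs.wnd_eq_zero_of_simplyConnected` (the discharge
«simply connected ⇒ no cycle winds about the root face»). Duminil-Copin and Smirnov point at the one place where
simple connectivity is used: «In order to evaluate the winding of γ₁ between p and q above, we used the fact that
a is on the boundary and Ω is simply connected» (arXiv:1007.0575v2, p. 4).

THIS FILE adds the complementary case — what happens when a loop DOES wind about the root face (the root on the
boundary of a HOLE of `V`) — and the resulting EXACT DEFECT, per vertex and summed:
* §1 ★★ `cturn_eq_six_mul_turn_of_wnd_ne_zero` — the loop lemma of `HexSAWWinding` in the enclosing case: a simple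
  cycle through `v` whose entrance face has NONZERO winding number turns by `+6τ` (the tree's
  `cturn_eq_neg_six_mul_turn`: `−6τ` when it vanishes);
* §2 `lw_isCyc`, `wnd_leftFace_entrance_eq` (the loop's winding number about the entrance face = about the root
  face), ★★ `pturn_lw_rev_eq` — the UNCONDITIONAL branch lemma: the two partners' windings differ by `8τ` if the
  loop does not wind about the root face and by `−16τ` if it does (per loop, no global hypothesis);
  `pturn_lw_rev_of_wnd_eq_zero` / `pair_sum_of_wnd_eq_zero` (per-loop refinements of the tree's global-`h₀`
  versions), ★ `pturn_lw_rev_of_wnd_ne_zero`, ★★ `pair_sum_of_wnd_ne_zero` — THE ENCLOSING PAIR DOES NOT CANCEL: it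
  sums to `−2ω·edir(v,s)·x_c^ℓ·λ^{W}` (`ω = e^{iπ/3}`; `e^{∓iσ8π/3}e^{∓iπ/3}` sum to `2cos 2π` where the
  non-enclosing `e^{±iσ4π/3}e^{∓iπ/3}` summed to `2cos(π/2) = 0`);
* §3 `loopWnd` (winding number of a loop walk's loop about the root face), ★★★ `sum_cv_eq_sum_encircling` — for
  EVERY finite `V ∌ w` and `v ∈ V` (no topological hypothesis) the left-hand side of the vertex relation EQUALS the
  sum of the contributions of the loop-class walks whose loop winds about the root face: THE EXACT DEFECT;
  `vertex_relation_of_loopWnd_eq_zero` (per-vertex local form: Lemma 1 at `v` as soon as no loop THROUGH `v` winds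
  about the root face — finer than a hypothesis on all cycles of `V`); an `example` recovers the tree's
  `vertex_relation_of_wnd` shape;
* §4 ★★ `boundary_sum_eq_add_defect` — identity (5) on an arbitrary finite domain: boundary sum = direction of `a`
  PLUS the total defect `Σ_v Σ_{encircling at v} c_v(γ)` — the honeycomb twin of the plaquette lane's total-defect
  identity (`PlaquetteWalkContourSum`).
Lane dictionary (numerics, exact enumeration 2026-08-24, HOME finding «HEX HOLE-ROOT DEFECT»): at `θ = π/3` the
square-encoded Yang–Baxter vertex functional of the catalogue equals `2√3·e^{−iπ/6}·(defect(T₁f) + defect(T₂f))`,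
`T₁f, T₂f` the two triangle centres of the rhombus `f`; so the venture lane's hole-root defect at the hexagonal
point is exactly the encircling-pair term of this file.

References: H. Duminil-Copin, S. Smirnov, Ann. of Math. 175 (2012), Lemma 1 and its proof, eq. (5)
[DuminilCopinSmirnov2012]. Status: lane theorem (the enclosing case and the explicit defect; the zero-winding half
is the tree's). Editions: ed.1 (unfiled) re-proved the zero-winding half under new names — withdrawn on the lead's
ruling r1a (gen 16); ed.2 = this file. Written for the venture lane «pcv-sawmu» (Tier B SEARCH 1, b-engine-1 gen 17).
-/

noncomputable section

open Finset Literature.Probability.LatticeModels Literature.Probability.Percolation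

namespace Literature.Probability.RandomPlanarGeometry.SAW

namespace HV

/-! ## §1. The loop lemma, enclosing case: a cycle seen from an INSIDE entrance edge turns by `+6τ` -/

/-- **Loop lemma, enclosing case.** A simple cycle `v :: L` of the honeycomb lattice, an edge `{v, s}` off
the cycle whose left face (seen from `v`) has NONZERO winding number — the entrance edge is INSIDE the
cycle — turns by `+2π·τ`, `τ = ±1` the turn `s → v → L.head` (against `−2π·τ` when the winding number
vanishes, `cturn_eq_neg_six_mul_turn`). [cite: DuminilCopinSmirnov2012, proof of Lemma 1 («we used the fact that a is on the boundary and Ω is simply connected»)] -/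
theorem cturn_eq_six_mul_turn_of_wnd_ne_zero {v : HV} {L : List HV} (hc : IsCyc (v :: L)) (hL : L ≠ [])
    {s : HV} (hs : hvGraph.Adj v s) (hsn : s ∉ v :: L) (h0 : wnd (v :: L) (leftFace v s) ≠ 0) :
    cturn (v :: L) = 6 * turn s v (L.head hL) := by
  have ht₁ : (v, L.head hL) ∈ cdarts (v :: L) := by rw [cdarts_cons, pdarts_cons_of_ne_nil _ hL]; simp
  have ht : (L.getLast hL, v) ∈ cdarts (v :: L) := by rw [cdarts_cons, List.getLast_cons hL]; simp
  have a₁ := hc.2.2 _ ht₁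
  have a₂ := (hc.2.2 _ ht).symm
  simp only at a₁ a₂
  have e0 := wnd_left_eq_right hc.2.2 hs (flux_eq_zero_of_not_mem (Or.inr hsn))
  have key : ∀ (w : ℤ), (w = 1 ∨ w = -1) → cturn (v :: L) = 6 * w →
      wnd (v :: L) (leftFace v (L.head hL)) = (w + 1) / 2 →
      wnd (v :: L) (rightFace v (L.head hL)) = (w - 1) / 2 →
      wnd (v :: L) (rightFace v (L.getLast hL)) = (w + 1) / 2 →
      wnd (v :: L) (leftFace v (L.getLast hL)) = (w - 1) / 2 →
      cturn (v :: L) = 6 * turn s v (L.head hL) := by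
    intro w hw hct l₁ r₁ l₂ r₂
    rw [hct]
    generalize L.head hL = t₁ at *
    generalize L.getLast hL = t at *
    obtain ⟨a, b, c⟩ := v
    obtain ⟨x, y, z⟩ := s
    obtain ⟨x₁, y₁, z₁⟩ := t₁
    obtain ⟨x₂, y₂, z₂⟩ := t
    cases c <;> cases z <;> simp only [hvGraph_adj, AdjRel] at hs <;> simp at hs <;>
      cases z₁ <;> simp only [hvGraph_adj, AdjRel] at a₁ <;> simp at a₁ <;>
      cases z₂ <;> simp only [hvGraph_adj, AdjRel] at a₂ <;> simp at a₂
    · rcases hs with ⟨e1, e2⟩ | ⟨e1, e2⟩ | ⟨e1, e2⟩ <;> rcases a₁ with ⟨f1, f2⟩ | ⟨f1, f2⟩ | ⟨f1, f2⟩ <;>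
        rcases a₂ with ⟨g1, g2⟩ | ⟨g1, g2⟩ | ⟨g1, g2⟩ <;> subst x y x₁ y₁ x₂ y₂ <;>
        simp only [leftFace_ff0, leftFace_ff1, leftFace_ff2, rightFace_ff0, rightFace_ff1, rightFace_ff2,
          turn_f01, turn_f12, turn_f20, turn_f10, turn_f21, turn_f02] at h0 e0 l₁ r₁ l₂ r₂ ⊢ <;> omega
    · rcases hs with ⟨e1, e2⟩ | ⟨e1, e2⟩ | ⟨e1, e2⟩ <;> rcases a₁ with ⟨f1, f2⟩ | ⟨f1, f2⟩ | ⟨f1, f2⟩ <;>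
        rcases a₂ with ⟨g1, g2⟩ | ⟨g1, g2⟩ | ⟨g1, g2⟩ <;> subst x y x₁ y₁ x₂ y₂ <;>
        simp only [leftFace_tt0, leftFace_tt1, leftFace_tt2, rightFace_tt0, rightFace_tt1, rightFace_tt2,
          turn_t01, turn_t12, turn_t20, turn_t10, turn_t21, turn_t02] at h0 e0 l₁ r₁ l₂ r₂ ⊢ <;> omega
  rcases good_or_good_reverse hc with hg | hg
  · have l₁ := hg.wnd_leftFace hc ht₁
    have r₁ := hg.2 _ ht₁
    have l₂ := hg.wnd_leftFace hc ht
    have r₂ := hg.2 _ ht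
    exact key 1 (Or.inl rfl) (by rw [hg.1]; norm_num) l₁ r₁ l₂ r₂
  · have hg' := (good_reverse_iff hc.1).1 hg
    have l₁ := hg'.2 _ ht₁
    have l₂ := hg'.2 _ ht
    have r₁ : wnd (v :: L) (rightFace v (L.head hL)) = -1 := by
      have := wnd_left_sub_right hc.2.2 a₁; rw [hc.flux_eq_one ht₁] at this; simp only at l₁; omega
    have r₂ : wnd (v :: L) (rightFace (L.getLast hL) v) = -1 := by
      have := wnd_left_sub_right hc.2.2 (hc.2.2 _ ht); rw [hc.flux_eq_one ht] at this; simp only at l₂ this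
      omega
    exact key (-1) (Or.inr rfl) (by rw [hg'.1]; norm_num) l₁ r₁ l₂ r₂

/-! ## §2. Pairs without the half-plane hypothesis: the winding of the loop about the ROOT FACE decides -/

section Pairs

variable {V : Finset HV} {P : List HV} {v : HV}

/-- The loop of a loop walk is a simple cycle of the lattice. [cite: DuminilCopinSmirnov2012, proof of Lemma 1] -/
theorem lw_isCyc (hw : wOut ∉ V) {l₁ l₂ : List HV} (hP : IsMidWalk V (lw l₁ v l₂)) (hl₂ : l₂ ≠ []) :
    IsCyc (v :: l₂) := by
  obtain ⟨hc, -, -, -, hnd, -⟩ :=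
    (isMidWalk_cons_append_iff V (l := l₁ ++ v :: l₂) (by simp) v).1 hP
  obtain ⟨-, -, hvg, -, -, -, -⟩ := lw_nbrs_of_not_mem hw hP hl₂
  have h2 := lw_two_le hP
  have hc2 : (v :: l₂).IsChain hvGraph.Adj := (List.isChain_append.1 hc).2.1
  have hlast : (v :: l₂).getLast (List.cons_ne_nil _ _) = l₂.getLast hl₂ := List.getLast_cons hl₂
  refine ⟨by simp; omega, (List.nodup_append.1 hnd).2.1, fun d hd => ?_⟩
  rw [cdarts_eq (List.cons_ne_nil _ _), List.mem_append, List.mem_singleton] at hd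
  rcases hd with hd | rfl
  · exact adj_of_mem_pdarts hc2 d hd
  · rw [hlast]; exact hvg.symm

/-- **The winding number of the loop about the entrance face equals its winding number about the ROOT FACE
`(1, 0)`** (the face to the right of the root dart `w → O`): the initial segment of the walk joins the two
without meeting the loop. [cite: DuminilCopinSmirnov2012, proof of Lemma 1] -/
theorem wnd_leftFace_entrance_eq (hw : wOut ∉ V) {l₁ l₂ : List HV} (hP : IsMidWalk V (lw l₁ v l₂))
    (hl₂ : l₂ ≠ []) : wnd (v :: l₂) (leftFace v (lwS l₁)) = wnd (v :: l₂) (1, 0) := by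
  obtain ⟨hc, hh, -, -, hnd, -⟩ :=
    (isMidWalk_cons_append_iff V (l := l₁ ++ v :: l₂) (by simp) v).1 hP
  have hcyc := lw_isCyc hw hP hl₂
  have hQc : (wOut :: (l₁ ++ [v])).IsChain hvGraph.Adj := by
    have e : lw l₁ v l₂ = (wOut :: (l₁ ++ [v])) ++ (l₂ ++ [v]) := by simp [lw]
    have hc' := hP.1
    rw [e] at hc'
    exact (List.isChain_append.1 hc').1
  have hQi : ∀ q ∈ (wOut :: (l₁ ++ [v])).tail.dropLast, q ∉ v :: l₂ := by
    intro q hq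
    simp only [List.tail_cons, List.dropLast_concat] at hq
    exact fun hm => (List.nodup_append.1 hnd).2.2 q hq q hm rfl
  have hd : (wOut, (l₁ ++ [v]).head (by simp)) ∈ pdarts (wOut :: (l₁ ++ [v])) := by
    rw [pdarts_cons_of_ne_nil wOut (by simp)]; exact List.mem_cons_self
  have hd' : (lwS l₁, v) ∈ pdarts (wOut :: (l₁ ++ [v])) := by
    rw [← List.cons_append, pdarts_append_singleton _ (List.cons_ne_nil _ _)]
    exact List.mem_append_right _ (List.mem_singleton_self _)
  have key := wnd_rightFace_pdarts_eq hcyc.2.2 _ hQc hQi _ hd _ hd'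
  have hO : (l₁ ++ [v]).head (by simp) = hvOrigin := by
    rcases eq_or_ne l₁ [] with rfl | hl₁
    · simpa using hh
    · rw [List.head_append_of_ne_nil hl₁]
      rw [List.head?_append_of_ne_nil _ hl₁] at hh
      exact (List.head_eq_iff_head?_eq_some hl₁).2 hh
  simp only [hO, show rightFace wOut hvOrigin = (1, 0) by decide] at key
  -- `rightFace s v = leftFace v s`
  rw [show leftFace v (lwS l₁) = rightFace (lwS l₁) v from rfl]
  exact key.symm

/-- **The windings of the two partners**, general form: they differ by `8τ` (units `π/3`) if the loop does
NOT wind about the root face, by `−16τ` if it DOES (`τ = ±1` the entrance turn).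
[cite: DuminilCopinSmirnov2012, proof of Lemma 1] -/
theorem pturn_lw_rev_eq (hw : wOut ∉ V) {l₁ l₂ : List HV} (hP : IsMidWalk V (lw l₁ v l₂)) (hl₂ : l₂ ≠ []) :
    pturn (lw l₁ v l₂.reverse) = pturn (lw l₁ v l₂) +
      (if wnd (v :: l₂) (1, 0) = 0 then 8 else -16) * turn (lwS l₁) v (l₂.head hl₂) := by
  obtain ⟨hc, hh, hadj, hlV, hnd, hne⟩ :=
    (isMidWalk_cons_append_iff V (l := l₁ ++ v :: l₂) (by simp) v).1 hP
  obtain ⟨hvs, hvh, hvg, hsh, hhg, hsg, hsn⟩ := lw_nbrs_of_not_mem hw hP hl₂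
  have hwnd := wnd_leftFace_entrance_eq hw hP hl₂
  have hcyc := lw_isCyc hw hP hl₂
  have h2 := lw_two_le hP
  obtain ⟨h, r, rfl⟩ := List.exists_cons_of_ne_nil hl₂
  have hr : r ≠ [] := by rintro rfl; simp at h2
  simp only [List.head_cons, List.getLast_cons hr] at hvh hvg hsh hhg hsg ⊢
  set s := lwS l₁ with hs_def
  set g := r.getLast hr with hg_def
  set τ := turn s v h with hτ
  have hlast : (v :: h :: r).getLast (List.cons_ne_nil _ _) = g := by
    rw [List.getLast_cons (List.cons_ne_nil _ _), List.getLast_cons hr]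
  -- the turning number of the loop: `∓6τ` according to the winding number about the root face
  have hct : cturn (v :: h :: r) = (if wnd (v :: h :: r) (1, 0) = 0 then -6 else 6) * τ := by
    split_ifs with h0
    · rw [← hwnd] at h0
      exact cturn_eq_neg_six_mul_turn hcyc (List.cons_ne_nil _ _) hvs hsn h0
    · rw [← hwnd] at h0
      exact cturn_eq_six_mul_turn_of_wnd_ne_zero hcyc (List.cons_ne_nil _ _) hvs hsn h0
  -- turns at `v`
  have t1 : turn g v h = -τ := turn_eq_neg_turn hvs hvh hvg hsh hhg hsg
  have t2 : turn s v g = -τ := turn_eq_neg_turn' hvs hvh hvg hsh hhg hsg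
  -- splitting the turn sums
  have e1 : pturn (lw l₁ v (h :: r)) = pturn (wOut :: l₁ ++ [v, h]) + pturn (v :: h :: r ++ [v]) := by
    have : lw l₁ v (h :: r) = (wOut :: l₁) ++ v :: h :: (r ++ [v]) := by simp [lw]
    rw [this, pturn_append_cons_cons]
    simp
  have er : (h :: r).reverse = g :: (r.dropLast.reverse ++ [h]) := by
    conv_lhs => rw [← List.dropLast_append_getLast hr]
    simp [hg_def]
  have e2 : pturn (lw l₁ v (h :: r).reverse) =
      pturn (wOut :: l₁ ++ [v, g]) + pturn (v :: (h :: r).reverse ++ [v]) := by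
    have : lw l₁ v (h :: r).reverse = (wOut :: l₁) ++ v :: g :: ((r.dropLast.reverse ++ [h]) ++ [v]) := by
      simp [lw, er]
    rw [this, pturn_append_cons_cons, er]
    simp
  have e3 : pturn (wOut :: l₁ ++ [v, h]) = pturn (wOut :: l₁ ++ [v]) + τ :=
    pturn_concat_turn (wOut :: l₁) (List.cons_ne_nil _ _) v h
  have e4 : pturn (wOut :: l₁ ++ [v, g]) = pturn (wOut :: l₁ ++ [v]) + turn s v g :=
    pturn_concat_turn (wOut :: l₁) (List.cons_ne_nil _ _) v g
  have e5 : pturn (v :: (h :: r).reverse ++ [v]) = -pturn (v :: h :: r ++ [v]) := by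
    rw [← pturn_reverse]; congr 1; simp
  have e6 : cturn (v :: h :: r) = pturn (v :: h :: r ++ [v]) + turn g v h := by
    rw [cturn, show (v :: h :: r).take 2 = [v, h] from rfl,
      pturn_concat_turn (v :: h :: r) (List.cons_ne_nil _ _) v h, hlast]
  rw [e2, e4, e5, e1, e3]
  split_ifs at hct ⊢ <;> linarith [hct, t1, t2, e6]

/-- Non-enclosing loops: the tree's `pturn_lw_rev` without the half-plane hypothesis. [cite: DuminilCopinSmirnov2012, proof of Lemma 1] -/
theorem pturn_lw_rev_of_wnd_eq_zero (hw : wOut ∉ V) {l₁ l₂ : List HV} (hP : IsMidWalk V (lw l₁ v l₂))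
    (hl₂ : l₂ ≠ []) (h0 : wnd (v :: l₂) (1, 0) = 0) :
    pturn (lw l₁ v l₂.reverse) = pturn (lw l₁ v l₂) + 8 * turn (lwS l₁) v (l₂.head hl₂) := by
  rw [pturn_lw_rev_eq hw hP hl₂, if_pos h0]

/-- **Enclosing loops: the windings differ by `−16τ`.** [cite: DuminilCopinSmirnov2012, proof of Lemma 1 («we used the fact that a is on the boundary and Ω is simply connected»)] -/
theorem pturn_lw_rev_of_wnd_ne_zero (hw : wOut ∉ V) {l₁ l₂ : List HV} (hP : IsMidWalk V (lw l₁ v l₂))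
    (hl₂ : l₂ ≠ []) (h1 : wnd (v :: l₂) (1, 0) ≠ 0) :
    pturn (lw l₁ v l₂.reverse) = pturn (lw l₁ v l₂) - 16 * turn (lwS l₁) v (l₂.head hl₂) := by
  rw [pturn_lw_rev_eq hw hP hl₂, if_neg h1]; ring

/-- **Non-enclosing pairs cancel** (DCS's pair identity `j λ̄⁴ + j̄ λ⁴ = 0`), for every finite `V ∌ w`.
[cite: DuminilCopinSmirnov2012, proof of Lemma 1] -/
theorem pair_sum_of_wnd_eq_zero (hw : wOut ∉ V) {l₁ l₂ : List HV} (hP : IsMidWalk V (lw l₁ v l₂))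
    (h0 : wnd (v :: l₂) (1, 0) = 0) :
    edir v (finalDart (lw l₁ v l₂)).1 * pwt (lw l₁ v l₂) +
      edir v (finalDart (lw l₁ v l₂.reverse)).1 * pwt (lw l₁ v l₂.reverse) = 0 := by
  have h2 := lw_two_le hP
  have hl₂ : l₂ ≠ [] := by rintro rfl; simp at h2
  obtain ⟨hvs, hvh, hvg, hsh, hhg, hsg, -⟩ := lw_nbrs_of_not_mem hw hP hl₂
  have hpt := pturn_lw_rev_of_wnd_eq_zero hw hP hl₂ h0
  rw [finalDart_lw _ _ hl₂, finalDart_lw _ _ (by simpa using hl₂)]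
  simp only [List.getLast_reverse, pwt, mwLen_lw, List.length_reverse, hpt]
  rcases adj_cases hvs hvh with e | e | e
  · exact absurd e.symm hsh
  · have e' : l₂.getLast hl₂ = cw v (lwS l₁) := by
      rcases adj_cases hvs hvg with e' | e' | e'
      · exact absurd e'.symm hsg
      · exact absurd (e.trans e'.symm) hhg
      · exact e'
    rw [e, e', turn_ccw hvs, edir_ccw hvs, edir_cw hvs,
      show pturn (lw l₁ v l₂) + 8 * -1 = pturn (lw l₁ v l₂) - 8 by ring]
    linear_combination
      ((hexCriticalFugacity : ℂ) ^ (l₁.length + l₂.length + 1) * edir v (lwS l₁)) *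
        pair_identity (pturn (lw l₁ v l₂))
  · have e' : l₂.getLast hl₂ = ccw v (lwS l₁) := by
      rcases adj_cases hvs hvg with e' | e' | e'
      · exact absurd e'.symm hsg
      · exact e'
      · exact absurd (e.trans e'.symm) hhg
    rw [e, e', turn_cw hvs, edir_ccw hvs, edir_cw hvs, mul_one]
    have key := pair_identity (pturn (lw l₁ v l₂) + 8)
    rw [Int.add_sub_cancel] at key
    linear_combination ((hexCriticalFugacity : ℂ) ^ (l₁.length + l₂.length + 1) * edir v (lwS l₁)) * key

/-- **ENCLOSING PAIRS DO NOT CANCEL**: if the loop winds about the root face, the two partners sum to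
`−2ω · (edir v s) · x_c^ℓ · λ^{W}`, `W` the winding (in units `π/3`) of the partner that enters the loop by
the turn `−1` (loop head `= ccw v s`), `s` the entrance vertex, `ω = e^{iπ/3}` — a NONZERO term: the two
windings now differ by `16·(π/3)` and `e^{∓iσ·8π/3}·e^{∓iπ/3}` sum to `2cos 2π = 2` where the non-enclosing
`e^{±iσ·4π/3}·e^{∓iπ/3}` summed to `2cos(π/2) = 0` (the `σ = 5/8` tuning).
[cite: DuminilCopinSmirnov2012, proof of Lemma 1 («we used the fact that a is on the boundary and Ω is simply connected»)] -/
theorem pair_sum_of_wnd_ne_zero (hw : wOut ∉ V) {l₁ l₂ : List HV} (hP : IsMidWalk V (lw l₁ v l₂))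
    (hl₂ : l₂ ≠ []) (hτ : turn (lwS l₁) v (l₂.head hl₂) = -1) (h1 : wnd (v :: l₂) (1, 0) ≠ 0) :
    edir v (finalDart (lw l₁ v l₂)).1 * pwt (lw l₁ v l₂) +
      edir v (finalDart (lw l₁ v l₂.reverse)).1 * pwt (lw l₁ v l₂.reverse) =
      -2 * omg * edir v (lwS l₁) * (hexCriticalFugacity : ℂ) ^ (l₁.length + l₂.length + 1) * lam ^ pturn (lw l₁ v l₂) := by
  obtain ⟨hvs, hvh, hvg, hsh, hhg, hsg, -⟩ := lw_nbrs_of_not_mem hw hP hl₂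
  have hpt := pturn_lw_rev_of_wnd_ne_zero hw hP hl₂ h1
  rw [finalDart_lw _ _ hl₂, finalDart_lw _ _ (by simpa using hl₂)]
  simp only [List.getLast_reverse, pwt, mwLen_lw, List.length_reverse, hpt, hτ]
  -- the loop head is `ccw v s` (right turn), the loop tail `cw v s`
  rcases adj_cases hvs hvh with e | e | e
  · exact absurd e.symm hsh
  · have e' : l₂.getLast hl₂ = cw v (lwS l₁) := by
      rcases adj_cases hvs hvg with e' | e' | e'
      · exact absurd e'.symm hsg
      · exact absurd (e.trans e'.symm) hhg
      · exact e'
    rw [e', e, edir_ccw hvs, edir_cw hvs, show pturn (lw l₁ v l₂) - 16 * -1 = pturn (lw l₁ v l₂) + 16 by ring,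
      zpow_add₀ lam_ne_zero, lam_zpow_sixteen]
    have hω := omg_sq
    linear_combination (edir v (lwS l₁) * (hexCriticalFugacity : ℂ) ^ (l₁.length + l₂.length + 1) *
      lam ^ pturn (lw l₁ v l₂) * omg) * hω
  · rw [e, turn_cw hvs] at hτ
    norm_num at hτ

end Pairs

/-! ## §3. The vertex relation on an arbitrary finite domain: the defect is the sum over the ENCIRCLING loop
walks; Lemma 1 whenever the root face is outside every cycle -/

section Main

variable {V : Finset HV} {v : HV}

open Classical in
/-- **The winding number of a loop walk's loop about the root face** (`0` on lists not of loop form): the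
integer that decides whether the walk's pair cancels. [cite: DuminilCopinSmirnov2012, proof of Lemma 1] -/
def loopWnd (v : HV) (P : List HV) : ℤ :=
  if h : ∃ l₁ l₂ : List HV, v ∉ l₁ ∧ P = lw l₁ v l₂ then wnd (v :: h.choose_spec.choose) (1, 0) else 0

/-- `loopWnd` of a loop walk. [cite: DuminilCopinSmirnov2012, proof of Lemma 1] -/
theorem loopWnd_lw {l₁ l₂ : List HV} (hv : v ∉ l₁) : loopWnd v (lw l₁ v l₂) = wnd (v :: l₂) (1, 0) := by
  have h : ∃ m₁ m₂ : List HV, v ∉ m₁ ∧ lw l₁ v l₂ = lw m₁ v m₂ := ⟨l₁, l₂, hv, rfl⟩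
  rw [loopWnd, dif_pos h]
  obtain ⟨hm, he⟩ := h.choose_spec.choose_spec
  have he' : l₁ ++ v :: l₂ = h.choose ++ v :: h.choose_spec.choose :=
    List.append_cancel_right (List.cons.inj he).2
  obtain ⟨-, e2⟩ := split_unique hv hm he'
  rw [← e2]

/-- Reversing the loop negates its winding number. [folklore: orientation reversal] [cite: DuminilCopinSmirnov2012, proof of Lemma 1] -/
theorem wnd_cons_reverse (v : HV) (l₂ : List HV) (F : ℤ × ℤ) : wnd (v :: l₂.reverse) F = -wnd (v :: l₂) F := by
  have e : v :: l₂.reverse = ((v :: l₂).reverse).rotate l₂.length := by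
    rw [List.reverse_cons, List.rotate_eq_drop_append_take (by simp)]
    simp
  rw [e, wnd_rotate, wnd_reverse]

/-- `loopWnd` of the partner walk is the negative. [cite: DuminilCopinSmirnov2012, proof of Lemma 1] -/
theorem loopWnd_loopRev {l₁ l₂ : List HV} (hv : v ∉ l₁) :
    loopWnd v (lw l₁ v l₂.reverse) = -loopWnd v (lw l₁ v l₂) := by
  rw [loopWnd_lw hv, loopWnd_lw hv, wnd_cons_reverse]

/-- ★★★ **THE VERTEX RELATION ON AN ARBITRARY FINITE DOMAIN: THE DEFECT IS CARRIED BY THE ENCIRCLING LOOP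
WALKS.** For every finite vertex set `V ∌ w` (the root mid-edge `a = {w, O}` may lie on the outer boundary
OR on the boundary of a hole of `V`) and every `v ∈ V`, the left-hand side
`Σ_γ c(γ) = (p−v)F(p) + (q−v)F(q) + (r−v)F(r)` of Duminil-Copin–Smirnov's relation equals the sum of the
contributions of the loop-class walks (`a → … → v`, a loop back to `v`, ending at the third mid-edge of
`v`) WHOSE LOOP WINDS ABOUT THE ROOT FACE: the triplets always cancel, a pair cancels iff its loop does
not wind about the root face. [cite: DuminilCopinSmirnov2012, Lemma 1 and its proof («we used the fact that a is on the boundary and Ω is simply connected»)] -/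
theorem sum_cv_eq_sum_encircling (hw : wOut ∉ V) (hvV : v ∈ V) :
    ∑ P ∈ midWalks V, cv v P =
      ∑ P ∈ (clsLoop V v).filter (fun P => loopWnd v P ≠ 0), edir v (finalDart P).1 * pwt P := by
  rw [sum_cv_eq]
  have h1 := sum_clsIn_add_clsOut hw hvV
  have h2 : ∑ P ∈ clsLoop V v, edir v (finalDart P).1 * pwt P =
      ∑ P ∈ (clsLoop V v).filter (fun P => loopWnd v P ≠ 0), edir v (finalDart P).1 * pwt P := by
    rw [← Finset.sum_filter_add_sum_filter_not (clsLoop V v) (fun P => loopWnd v P ≠ 0)]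
    have h0 : ∑ P ∈ (clsLoop V v).filter (fun P => ¬ loopWnd v P ≠ 0), edir v (finalDart P).1 * pwt P = 0 := by
      refine Finset.sum_involution (fun P _ => loopRev v P) (fun P hP => ?_) (fun P hP _ => ?_)
        (fun P hP => ?_) (fun P hP => ?_)
      · obtain ⟨hP, hz⟩ := mem_filter.1 hP
        obtain ⟨l₁, l₂, hv₁, rfl⟩ := exists_eq_lw hP
        rw [loopRev_lw hv₁]
        rw [not_not, loopWnd_lw hv₁] at hz
        exact pair_sum_of_wnd_eq_zero hw (mem_midWalks_iff.1 (mem_filter.1 hP).1) hz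
      · obtain ⟨hP, -⟩ := mem_filter.1 hP
        obtain ⟨l₁, l₂, hv₁, rfl⟩ := exists_eq_lw hP
        rw [loopRev_lw hv₁]
        exact lw_rev_ne (mem_midWalks_iff.1 (mem_filter.1 hP).1)
      · obtain ⟨hP, hz⟩ := mem_filter.1 hP
        obtain ⟨l₁, l₂, hv₁, rfl⟩ := exists_eq_lw hP
        have hPw := mem_midWalks_iff.1 (mem_filter.1 hP).1
        have h2 := lw_two_le hPw
        have hl₂ : l₂.reverse ≠ [] := by intro h; rw [List.reverse_eq_nil_iff] at h; subst h; simp at h2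
        rw [loopRev_lw hv₁, mem_filter, clsLoop, mem_filter, mem_midWalks_iff, finalDart_lw _ _ hl₂, inner_lw,
          loopWnd_loopRev hv₁]
        exact ⟨⟨lw_rev_isMidWalk hPw, rfl, by simp⟩, by rw [not_not] at hz ⊢; rw [hz, neg_zero]⟩
      · obtain ⟨hP, -⟩ := mem_filter.1 hP
        obtain ⟨l₁, l₂, hv₁, rfl⟩ := exists_eq_lw hP
        simp only [loopRev_lw hv₁, List.reverse_reverse]
    rw [h0, add_zero]
  rw [h2, ← add_assoc, add_comm (∑ P ∈ clsOut V v, edir v (finalDart P).2 * pwt P), h1, zero_add]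

/-- ★★★ **DCS's Lemma 1 at every vertex through which no loop winds about the root face.** If every walk of
the loop class at `v` has `loopWnd = 0`, the vertex relation holds at `v` — whatever the rest of the domain
looks like. [cite: DuminilCopinSmirnov2012, Lemma 1] -/
theorem vertex_relation_of_loopWnd_eq_zero (hw : wOut ∉ V) (hvV : v ∈ V)
    (h0 : ∀ P ∈ clsLoop V v, loopWnd v P = 0) : ∑ P ∈ midWalks V, cv v P = 0 := by
  rw [sum_cv_eq_sum_encircling hw hvV]
  refine Finset.sum_eq_zero fun P hP => ?_
  obtain ⟨hP, hz⟩ := mem_filter.1 hP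
  exact absurd (h0 P hP) hz

/-- The tree's `vertex_relation_of_wnd` (`HexParafermionLoop`) recovered from the per-vertex form: if no simple
cycle of `V` winds about the root face, no loop walk does. [cite: DuminilCopinSmirnov2012, Lemma 1] -/
example (hw : wOut ∉ V) (h₀ : ∀ c : List HV, (∀ x ∈ c, x ∈ V) → IsCyc c → wnd c (1, 0) = 0) {v : HV}
    (hvV : v ∈ V) : ∑ P ∈ midWalks V, cv v P = 0 := by
  refine vertex_relation_of_loopWnd_eq_zero hw hvV fun P hP => ?_
  obtain ⟨l₁, l₂, hv₁, rfl⟩ := exists_eq_lw hP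
  have hPw := mem_midWalks_iff.1 (mem_filter.1 hP).1
  have h2 := lw_two_le hPw
  have hl₂ : l₂ ≠ [] := by rintro rfl; simp at h2
  rw [loopWnd_lw hv₁]
  refine h₀ _ (fun x hx => ?_) (lw_isCyc hw hPw hl₂)
  obtain ⟨-, -, -, hlV, -, -⟩ := (isMidWalk_cons_append_iff V (l := l₁ ++ v :: l₂) (by simp) v).1 hPw
  exact hlV x (by simp only [List.mem_append, List.mem_cons] at hx ⊢; tauto)

end Main

/-! ## §4. Summing over the domain: DCS's boundary identity (5) on an arbitrary finite domain, with the
hole defect -/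

section Boundary

variable {V : Finset HV}

/-- ★★★ **DCS's boundary identity on an ARBITRARY finite domain, with the defect.** Summing the vertex sums
over `v ∈ V` («values at interior mid-edges disappear»): the sum over all nontrivial walks ending on a
boundary mid-edge of `(direction of the final half-edge)·x_c^ℓ·e^{−iσW}` equals the direction of the starting
half-edge PLUS the total defect `Σ_{v ∈ V} Σ_{γ encircling at v} c_v(γ)` — the honeycomb form of the lane's
total-defect identity (`PlaquetteWalkContourSum`); when no cycle of `V` winds about the root face the defect vanishes
and this is the tree's `boundary_sum_weighted` (`HexParafermionWeighted`, `S = ∅`) / `boundary_sum`. [cite: DuminilCopinSmirnov2012, proof of Lemma 2 (eq. (5): «Sum the relation (2) over all vertices … Values at interior mid-edges disappear»)] -/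
theorem boundary_sum_eq_add_defect (hw : wOut ∉ V) (hO : hvOrigin ∈ V) :
    ∑ P ∈ (midWalks V).filter (fun P => P ≠ [wOut, hvOrigin] ∧ (finalDart P).2 ∉ V),
      edir (finalDart P).1 (finalDart P).2 * pwt P =
      edir wOut hvOrigin +
        ∑ v ∈ V, ∑ P ∈ (clsLoop V v).filter (fun P => loopWnd v P ≠ 0), edir v (finalDart P).1 * pwt P := by
  have h0 : ∑ P ∈ midWalks V, ∑ v ∈ V, cv v P =
      ∑ v ∈ V, ∑ P ∈ (clsLoop V v).filter (fun P => loopWnd v P ≠ 0), edir v (finalDart P).1 * pwt P := by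
    rw [sum_comm]; exact sum_congr rfl fun v hv => sum_cv_eq_sum_encircling hw hv
  have h1 : ∀ P ∈ midWalks V, ∑ v ∈ V, cv v P =
      (if P = [wOut, hvOrigin] then edir hvOrigin wOut else 0) +
      (if P ≠ [wOut, hvOrigin] ∧ (finalDart P).2 ∉ V then
        edir (finalDart P).1 (finalDart P).2 * pwt P else 0) := by
    intro P hP
    rw [mem_midWalks_iff] at hP
    rw [sum_cv_comm]
    by_cases ht : P = [wOut, hvOrigin]
    · subst ht
      simp [finalDart_trivial, hw, hO, pwt]
    · have h1 : (finalDart P).1 ∈ V := finalDart_fst_mem hP ht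
      by_cases h2 : (finalDart P).2 ∈ V
      · simp only [h1, h2, if_true, ht, if_false, not_true_eq_false, and_false, add_zero,
          ne_eq, not_false_eq_true, edir_rev (finalDart P).1 (finalDart P).2, add_neg_cancel,
          zero_mul]
      · simp [h1, h2, ht]
  rw [sum_congr rfl h1, sum_add_distrib, sum_ite_eq' (midWalks V) [wOut, hvOrigin],
    if_pos (mem_midWalks_iff.2 (isMidWalk_trivial V)), ← sum_filter] at h0
  rw [edir_rev wOut hvOrigin] at h0
  linear_combination h0

end Boundary

end HV

end Literature.Probability.RandomPlanarGeometry.SAW
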